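import Summits.ValiantsHypothesis.ValiantsHypothesis.Theorems.KPlusLogSqLawOctaveTempered

/-!
# Route «KPlusLogSqLaw», octave line — MOVING FRAMES DEFEAT EVERY BASIS: a symmetric `(2,7)` family whose conjugates `(G S_l H)_l` are never root-tempered, while a same-exponent re-lettering of the same determinant is `0`-tempered

HONEST FRAMING.  Prover seat val-width-19561-oc1 (g3), `--supports stmt-ValiantsHypothesis-19561` (crux `WeakLifting`, OPEN), octave line of
val-idea-6.  This file is a NEGATIVE calibration lemma for the tempered-lifting METHOD (files `…OctaveTempered`, `…OctaveTemperedGlue`): it shows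
that the basis-free form `octaveCount_le_of_rootTempered_conj` cannot by itself reach Ω-W (no uniform temper survives conjugation), and that the
quantifier «some same-format REPRESENTATION» of `TemperedRepresentability` / `FreeTemperedRepresentability` (DEFINED, NOT asserted) is the
right one for this family.  Nothing is claimed about `OctaveWeakLifting`, `WeakLifting`, `TropicalB`, Conjecture B; VP ≠ VNP is not moved.

THE FAMILY (exponent RESONANCE, not orthogonality).  `F_a(x) = U(x)ᵀ · diag(x − 2, x² − 3) · U(x)` with the moving frame `U(x) = I + x^a E₁₂`:
`F_a = [[x − 2, x^{a+1} − 2x^a], [x^{a+1} − 2x^a, x^{2a+1} − 2x^{2a} + x² − 3]]`, a real SYMMETRIC pencil on the seven exponents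
`(0, 1, 2, a, a+1, 2a, 2a+1)` (`frameExp a`, `frameLetters`), `det F_a = (x − 2)(x² − 3)` for every `a` (`pencilDet_frame`).  At the root `x = 2`
(`θ = 1`) the class `2a + 2` is PRESENT and DEAD (raw terms `x · x^{2a+1}` and `−(x^{a+1})²` cancel by the resonance `1 + (2a+1) = 2(a+1)`), and in
EVERY two-sided basis one of the four raw terms `{G₀₀G₁₁, G₁₀G₀₁} × {H₀₀H₁₁, H₀₁H₁₀}` of that class has modulus `≥ |det G·det H|/4`
(`abs_frameRaw_ge`), i.e. sits `≥ 2a − O(1)` bits above the true Newton top `8|det G det H|` at `θ = 1`: `not_rootTempered_frame_conj`.  The same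
determinant is the determinant of the DIAGONAL same-exponent pencil `diag(x − 2, x² − 3)` (`frameDiag`, `pencilDet_frameDiag`), whose classes are
singly occupied, hence `0`-tempered at every scale (`temperedAt_zero_of_single`, `temperedAt_frameDiag`).  Packaged: `exists_symm_pencil_untempered_conj`.
-/

set_option linter.dupNamespace false
set_option autoImplicit false

namespace Summit.ValiantsHypothesis.ValiantsHypothesis.Theorems.KPlusLogSqLaw.Octave

open Polynomial Finset
open scoped BigOperators

section Frames

open Finset

variable {m K : ℕ}

/-- with DIAGONAL letters only the identity permutation carries present raw terms. [folklore] -/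
theorem rawCoef_eq_zero_of_diag (S : Fin K → Matrix (Fin m) (Fin m) ℝ) (hS : ∀ l i j, i ≠ j → S l i j = 0)
    (τ : RawTerm m K) (hσ : τ.1 ≠ 1) : rawCoef S τ = 0 := by
  obtain ⟨i, hi⟩ : ∃ i, τ.1 i ≠ i := by
    by_contra h
    push Not at h
    exact hσ (Equiv.ext h)
  rw [rawCoef]
  have : ∏ j, S (τ.2 j) (τ.1 j) j = 0 := Finset.prod_eq_zero (Finset.mem_univ i) (hS _ _ _ hi)
  rw [this, mul_zero]

/-- **singly occupied classes are `0`-tempered**: if no two distinct present raw terms share a slope class, every present raw line IS the true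
Newton line of its class, so the pencil is `0`-tempered at every scale. [folklore] -/
theorem temperedAt_zero_of_single (d : Fin K → ℕ) (S : Fin K → Matrix (Fin m) (Fin m) ℝ)
    (h : ∀ τ τ' : RawTerm m K, rawCoef S τ ≠ 0 → rawCoef S τ' ≠ 0 → rawSlope d τ = rawSlope d τ' → τ = τ') (θ : ℝ) :
    TemperedAt d S 0 θ := by
  classical
  intro τ hτ
  have hcoeff : (pencilDet d S).coeff (rawSlope d τ) = rawCoef S τ := by
    rw [coeff_pencilDet_eq_sum]
    rw [Finset.sum_eq_single τ]
    · intro τ' hτ' hne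
      by_contra hz
      exact hne (h τ' τ hz hτ (mem_filter.1 hτ').2)
    · intro hnot
      exact absurd (by simp) hnot
  refine ⟨rawSlope d τ, Polynomial.mem_support_iff.2 (by rw [hcoeff]; exact hτ), ?_⟩
  rw [rawLine, newtonLog, hcoeff, rawLog]
  push_cast
  linarith

/-- exponents of the moving-frame family: `(0, 1, 2, a, a+1, 2a, 2a+1)`. [definition of the seat] -/
def frameExp (a : ℕ) : Fin 7 → ℕ := ![0, 1, 2, a, a + 1, 2 * a, 2 * a + 1]

/-- letters of the moving-frame family `U(x)ᵀ diag(x − 2, x² − 3) U(x)`, `U = I + x^a E₁₂` (all symmetric). [definition of the seat] -/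
def frameLetters : Fin 7 → Matrix (Fin 2) (Fin 2) ℝ :=
  ![!![-2, 0; 0, -3], !![1, 0; 0, 0], !![0, 0; 0, 1], !![0, -2; -2, 0], !![0, 1; 1, 0], !![0, 0; 0, -2], !![0, 0; 0, 1]]

/-- the honest re-lettering on the SAME exponents: `diag(x − 2, x² − 3)` (letters `3…6` zero). [definition of the seat] -/
def frameDiag : Fin 7 → Matrix (Fin 2) (Fin 2) ℝ :=
  ![!![-2, 0; 0, -3], !![1, 0; 0, 0], !![0, 0; 0, 1], 0, 0, 0, 0]

/-- the letters of the family are symmetric. [folklore] -/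
theorem frameLetters_isSymm (l : Fin 7) : (frameLetters l).IsSymm := by
  fin_cases l <;> (unfold Matrix.IsSymm; ext i j; fin_cases i <;> fin_cases j <;> simp [frameLetters])


/-- the determinant of the family: `det F_a = x³ − 2x² − 3x + 6 = (x − 2)(x² − 3)` for every `a` (the frame is unimodular). [folklore] -/
theorem pencilDet_frame (a : ℕ) :
    pencilDet (frameExp a) frameLetters = (X ^ 3 - C 2 * X ^ 2 - C 3 * X + C 6 : ℝ[X]) := by
  unfold pencilDet
  rw [Matrix.det_fin_two]
  simp [Matrix.sum_apply, Fin.sum_univ_succ, frameExp, frameLetters]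
  have h6 : (C 6 : ℝ[X]) = C 2 * C 3 := by rw [← map_mul]; norm_num
  rw [h6]; ring

/-- the diagonal re-lettering has the same determinant. [folklore] -/
theorem pencilDet_frameDiag (a : ℕ) :
    pencilDet (frameExp a) frameDiag = (X ^ 3 - C 2 * X ^ 2 - C 3 * X + C 6 : ℝ[X]) := by
  unfold pencilDet
  rw [Matrix.det_fin_two]
  simp [Matrix.sum_apply, Fin.sum_univ_succ, frameExp, frameDiag]
  have h6 : (C 6 : ℝ[X]) = C 2 * C 3 := by rw [← map_mul]; norm_num
  rw [h6]; ring


/-! #### The diagonal re-lettering is `0`-tempered everywhere -/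

/-- the re-lettering is diagonal. [folklore] -/
theorem frameDiag_offDiag (l : Fin 7) (i j : Fin 2) (hij : i ≠ j) : frameDiag l i j = 0 := by
  fin_cases l <;> fin_cases i <;> fin_cases j <;> simp_all [frameDiag]

/-- which letters are present in slot `(0,0)`. [folklore] -/
theorem frameDiag_fst (l : Fin 7) (h : frameDiag l 0 0 ≠ 0) : l = 0 ∨ l = 1 := by
  fin_cases l <;> simp_all [frameDiag]

/-- which letters are present in slot `(1,1)`. [folklore] -/
theorem frameDiag_snd (l : Fin 7) (h : frameDiag l 1 1 ≠ 0) : l = 0 ∨ l = 2 := by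
  fin_cases l <;> simp_all [frameDiag]

/-- raw terms of the re-lettering along the identity permutation. [folklore] -/
theorem rawCoef_frameDiag_one (lam : Fin 2 → Fin 7) :
    rawCoef frameDiag ((1 : Equiv.Perm (Fin 2)), lam) = frameDiag (lam 0) 0 0 * frameDiag (lam 1) 1 1 := by
  simp [rawCoef, Fin.prod_univ_two]

/-- the classes of the re-lettering are singly occupied. [folklore] -/
theorem frameDiag_single (a : ℕ) : ∀ τ τ' : RawTerm 2 7, rawCoef frameDiag τ ≠ 0 → rawCoef frameDiag τ' ≠ 0 →
    rawSlope (frameExp a) τ = rawSlope (frameExp a) τ' → τ = τ' := by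
  rintro ⟨σ, lam⟩ ⟨σ', lam'⟩ h h' hs
  have hσ : σ = 1 := by
    by_contra hne; exact h (rawCoef_eq_zero_of_diag frameDiag frameDiag_offDiag (σ, lam) hne)
  have hσ' : σ' = 1 := by
    by_contra hne; exact h' (rawCoef_eq_zero_of_diag frameDiag frameDiag_offDiag (σ', lam') hne)
  subst hσ hσ'
  rw [rawCoef_frameDiag_one] at h h'
  have h0 := frameDiag_fst (lam 0) (left_ne_zero_of_mul h)
  have h1 := frameDiag_snd (lam 1) (right_ne_zero_of_mul h)
  have h0' := frameDiag_fst (lam' 0) (left_ne_zero_of_mul h')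
  have h1' := frameDiag_snd (lam' 1) (right_ne_zero_of_mul h')
  simp only [rawSlope, Fin.sum_univ_two] at hs
  have key : lam 0 = lam' 0 ∧ lam 1 = lam' 1 := by
    rcases h0 with e0 | e0 <;> rcases h1 with e1 | e1 <;> rcases h0' with e0' | e0' <;> rcases h1' with e1' | e1' <;>
      simp [e0, e1, e0', e1', frameExp] at hs ⊢
  refine Prod.ext rfl (funext fun i => ?_)
  fin_cases i
  · exact key.1
  · exact key.2

/-- the diagonal re-lettering is `0`-tempered at every scale. [folklore] -/
theorem temperedAt_frameDiag (a : ℕ) (θ : ℝ) : TemperedAt (frameExp a) frameDiag 0 θ :=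
  temperedAt_zero_of_single _ _ (frameDiag_single a) θ

/-! #### In every two-sided basis a resonant dead raw term towers over the truth at the root `x = 2` -/

/-- the conjugated letter `x¹`: `(G E₁₁ H)_{ij} = G_{i0} H_{0j}`. [folklore] -/
theorem frame_conj_letter1 (G H : Matrix (Fin 2) (Fin 2) ℝ) (i j : Fin 2) :
    (G * frameLetters 1 * H) i j = G i 0 * H 0 j := by
  simp [frameLetters, Matrix.mul_apply, Fin.sum_univ_two]

/-- the conjugated letter `x^{2a+1}`: `(G E₂₂ H)_{ij} = G_{i1} H_{1j}`. [folklore] -/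
theorem frame_conj_letter6 (G H : Matrix (Fin 2) (Fin 2) ℝ) (i j : Fin 2) :
    (G * frameLetters 6 * H) i j = G i 1 * H 1 j := by
  simp [frameLetters, Matrix.mul_apply, Fin.sum_univ_two]

/-- the four resonant raw terms of class `2a + 2` in the basis `(G, H)`. [folklore] -/
theorem rawCoef_frame_conj (G H : Matrix (Fin 2) (Fin 2) ℝ) :
    rawCoef (fun l => G * frameLetters l * H) ((1 : Equiv.Perm (Fin 2)), ![1, 6]) = (G 0 0 * G 1 1) * (H 0 0 * H 1 1) ∧
    rawCoef (fun l => G * frameLetters l * H) (Equiv.swap 0 1, ![1, 6]) = -((G 0 1 * G 1 0) * (H 0 0 * H 1 1)) ∧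
    rawCoef (fun l => G * frameLetters l * H) ((1 : Equiv.Perm (Fin 2)), ![6, 1]) = (G 0 1 * G 1 0) * (H 0 1 * H 1 0) ∧
    rawCoef (fun l => G * frameLetters l * H) (Equiv.swap 0 1, ![6, 1]) = -((G 0 0 * G 1 1) * (H 0 1 * H 1 0)) := by
  have hs : Equiv.Perm.sign (Equiv.swap (0 : Fin 2) 1) = -1 := Equiv.Perm.sign_swap (by decide)
  refine ⟨?_, ?_, ?_, ?_⟩ <;>
    simp [rawCoef, Fin.prod_univ_two, frame_conj_letter1, frame_conj_letter6, hs, Equiv.swap_apply_left,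
      Equiv.swap_apply_right] <;> ring

/-- the resonant raw terms have slope `2a + 2`. [folklore] -/
theorem rawSlope_frame (a : ℕ) (σ : Equiv.Perm (Fin 2)) :
    rawSlope (frameExp a) (σ, ![1, 6]) = 2 * a + 2 ∧ rawSlope (frameExp a) (σ, ![6, 1]) = 2 * a + 2 := by
  constructor <;> (simp [rawSlope, Fin.sum_univ_two, frameExp] <;> omega)

/-- **in every basis one resonant raw term is large**: some raw term of slope `2a + 2` has modulus `≥ |det G · det H| / 4`. [folklore] -/
theorem exists_frameRaw_large (a : ℕ) (G H : Matrix (Fin 2) (Fin 2) ℝ) :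
    ∃ τ : RawTerm 2 7, rawSlope (frameExp a) τ = 2 * a + 2 ∧
      |G.det * H.det| / 4 ≤ |rawCoef (fun l => G * frameLetters l * H) τ| := by
  obtain ⟨r1, r2, r3, r4⟩ := rawCoef_frame_conj G H
  have hG : G.det = G 0 0 * G 1 1 - G 0 1 * G 1 0 := Matrix.det_fin_two G
  have hH : H.det = H 0 0 * H 1 1 - H 0 1 * H 1 0 := Matrix.det_fin_two H
  set A1 := G 0 0 * G 1 1
  set A2 := G 0 1 * G 1 0
  set B1 := H 0 0 * H 1 1
  set B2 := H 0 1 * H 1 0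
  have hA : |G.det| ≤ |A1| + |A2| := by rw [hG]; exact abs_sub _ _
  have hB : |H.det| ≤ |B1| + |B2| := by rw [hH]; exact abs_sub _ _
  have hGH : |G.det * H.det| = |G.det| * |H.det| := abs_mul _ _
  have key : ∀ (A B : ℝ), |G.det| ≤ 2 * |A| → |H.det| ≤ 2 * |B| → |G.det * H.det| / 4 ≤ |A * B| := by
    intro A B h1 h2
    rw [hGH, abs_mul]
    have := mul_le_mul h1 h2 (abs_nonneg _) (by positivity)
    linarith
  rcases le_or_gt |A2| |A1| with hA1 | hA2 <;> rcases le_or_gt |B2| |B1| with hB1 | hB2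
  · exact ⟨(1, ![1, 6]), (rawSlope_frame a 1).1, by rw [r1]; exact key A1 B1 (by linarith) (by linarith)⟩
  · refine ⟨(Equiv.swap 0 1, ![6, 1]), (rawSlope_frame a _).2, ?_⟩
    rw [r4, abs_neg]; exact key A1 B2 (by linarith) (by linarith)
  · refine ⟨(Equiv.swap 0 1, ![1, 6]), (rawSlope_frame a _).1, ?_⟩
    rw [r2, abs_neg]; exact key A2 B1 (by linarith) (by linarith)
  · exact ⟨(1, ![6, 1]), (rawSlope_frame a 1).2, by rw [r3]; exact key A2 B2 (by linarith) (by linarith)⟩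

/-- coefficients of `x³ − 2x² − 3x + 6`: supported on `e ≤ 3`, bounded by `6`. [folklore] -/
theorem frame_coeff (e : ℕ) (h : (X ^ 3 - C 2 * X ^ 2 - C 3 * X + C 6 : ℝ[X]).coeff e ≠ 0) :
    e ≤ 3 ∧ |(X ^ 3 - C 2 * X ^ 2 - C 3 * X + C 6 : ℝ[X]).coeff e| ≤ 6 := by
  by_cases he : e ≤ 3
  · refine ⟨he, ?_⟩
    interval_cases e <;> simp [coeff_X_pow, coeff_C, coeff_X, coeff_C_mul] <;> norm_num
  · exfalso
    apply h
    have h3 : e ≠ 3 := by omega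
    have h2 : e ≠ 2 := by omega
    have h1 : (1 : ℕ) ≠ e := by omega
    have h0 : e ≠ 0 := by omega
    simp [coeff_X_pow, coeff_C, coeff_X, coeff_C_mul, h0, h1, h2, h3]

/-- **NO BASIS IS TEMPERED** (the negative calibration lemma): for the symmetric `(2,7)` pencil `F_{W+4}` and ANY invertible `G, H`, the
conjugate `(G S_l H)_l` is not `W`-root-tempered — at the root `x = 2` a resonant dead raw term of slope `2a+2` is `≥ 2a − 5 > W` bits above the
true Newton top. [folklore] -/
theorem not_rootTempered_frame_conj (W : ℕ) (G H : Matrix (Fin 2) (Fin 2) ℝ) (hG : G.det ≠ 0) (hH : H.det ≠ 0) :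
    ¬ RootTempered (frameExp (W + 4)) (fun l => G * frameLetters l * H) W := by
  intro hT
  set a := W + 4 with ha
  set S' : Fin 7 → Matrix (Fin 2) (Fin 2) ℝ := fun l => G * frameLetters l * H with hS'
  set c := G.det * H.det with hc
  have hc0 : c ≠ 0 := mul_ne_zero hG hH
  have hcpos : 0 < |c| := abs_pos.2 hc0
  have hf' : pencilDet (frameExp a) S' = Polynomial.C c * (X ^ 3 - C 2 * X ^ 2 - C 3 * X + C 6) := by
    rw [hS', pencilDet_conj, pencilDet_frame]
  have hroot : (pencilDet (frameExp a) S').IsRoot 2 := by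
    rw [hf', Polynomial.IsRoot]
    simp
    norm_num
  have hθ : Real.logb 2 |(2 : ℝ)| = 1 := by
    rw [abs_of_pos two_pos]; exact Real.logb_self_eq_one one_lt_two
  have hTA := hT 2 two_ne_zero hroot
  rw [hθ] at hTA
  obtain ⟨τ, hslope, hbig⟩ := exists_frameRaw_large a G H
  have hquart : 0 < |c| / 4 := by positivity
  have hτpos : 0 < |rawCoef S' τ| := lt_of_lt_of_le hquart hbig
  obtain ⟨e, he, hle⟩ := hTA τ (abs_pos.1 hτpos)
  -- the Newton side
  have hcoeff : (pencilDet (frameExp a) S').coeff e = c * (X ^ 3 - C 2 * X ^ 2 - C 3 * X + C 6 : ℝ[X]).coeff e := by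
    rw [hf', Polynomial.coeff_C_mul]
  have hpe : (X ^ 3 - C 2 * X ^ 2 - C 3 * X + C 6 : ℝ[X]).coeff e ≠ 0 := by
    intro h0
    have := Polynomial.mem_support_iff.1 he
    rw [hcoeff, h0, mul_zero] at this
    exact this rfl
  obtain ⟨he3, hp6⟩ := frame_coeff e hpe
  have hN : newtonLog (pencilDet (frameExp a) S') e ≤ Real.logb 2 |c| + Real.logb 2 6 := by
    rw [newtonLog, hcoeff, abs_mul, Real.logb_mul hcpos.ne' (abs_pos.2 hpe).ne']
    have := Real.logb_le_logb_of_le (b := 2) (by norm_num) (abs_pos.2 hpe) hp6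
    linarith
  have h6 : Real.logb 2 6 < 3 := by
    have h68 : Real.logb 2 6 < Real.logb 2 8 := Real.logb_lt_logb (by norm_num) (by norm_num) (by norm_num)
    have h8 : Real.logb 2 8 = 3 := by
      rw [show (8 : ℝ) = 2 ^ (3 : ℕ) by norm_num, Real.logb_pow, Real.logb_self_eq_one one_lt_two]; norm_num
    linarith
  -- the raw side
  have hR : Real.logb 2 |c| - 2 + ((2 * a + 2 : ℕ) : ℝ) ≤ rawLine (frameExp a) S' τ 1 := by
    rw [rawLine, hslope, rawLog, mul_one]
    have h1 := Real.logb_le_logb_of_le (b := 2) (by norm_num) hquart hbig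
    rw [Real.logb_div hcpos.ne' (by norm_num)] at h1
    have h4 : Real.logb 2 4 = 2 := by
      rw [show (4 : ℝ) = 2 ^ (2 : ℕ) by norm_num, Real.logb_pow, Real.logb_self_eq_one one_lt_two]; norm_num
    rw [h4] at h1
    linarith
  have he3' : (e : ℝ) ≤ 3 := by exact_mod_cast he3
  have ha' : ((2 * a + 2 : ℕ) : ℝ) = 2 * W + 10 := by rw [ha]; push_cast; ring
  rw [ha'] at hR
  linarith

/-- in particular the pencil itself (basis `G = H = 1`) is not `W`-root-tempered. [folklore] -/
theorem not_rootTempered_frame (W : ℕ) : ¬ RootTempered (frameExp (W + 4)) frameLetters W := by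
  have h := not_rootTempered_frame_conj W 1 1 (by simp) (by simp)
  simpa using h

/-- **MOVING FRAMES DEFEAT EVERY BASIS, NOT RE-LETTERING** (packaged): for every temper `W` there is a real SYMMETRIC `(2,7)` pencil none of
whose two-sided conjugates `(G S_l H)_l` (`G, H` invertible) is `W`-root-tempered, although a re-lettering on the SAME exponents has the same
determinant and is `0`-tempered at every scale.  So `octaveCount_le_of_rootTempered_conj` alone cannot reach Ω-W, while the representation
quantifier of `TemperedRepresentability` survives this family. [folklore] -/
theorem exists_symm_pencil_untempered_conj (W : ℕ) :
    ∃ (d : Fin 7 → ℕ) (S : Fin 7 → Matrix (Fin 2) (Fin 2) ℝ), (∀ l, (S l).IsSymm) ∧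
      (∀ G H : Matrix (Fin 2) (Fin 2) ℝ, G.det ≠ 0 → H.det ≠ 0 → ¬ RootTempered d (fun l => G * S l * H) W) ∧
      ∃ S' : Fin 7 → Matrix (Fin 2) (Fin 2) ℝ, pencilDet d S' = pencilDet d S ∧ ∀ θ : ℝ, TemperedAt d S' 0 θ :=
  ⟨frameExp (W + 4), frameLetters, frameLetters_isSymm, fun G H hG hH => not_rootTempered_frame_conj W G H hG hH,
    frameDiag, by rw [pencilDet_frameDiag, pencilDet_frame], temperedAt_frameDiag (W + 4)⟩

end Frames

end Summit.ValiantsHypothesis.ValiantsHypothesis.Theorems.KPlusLogSqLaw.Octave
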